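import Summits.Ventures.PercRepro.RankLevelSetLevelSixHeavyCellSq27DI2VTop
import Summits.Ventures.PercRepro.RankLevelSetColoopDeviceRows
import Summits.Ventures.PercRepro.RankLevelSetColoopDeviceRowsArith20
import Summits.Ventures.PercRepro.RankLevelSetColoopDeviceT22Nine
import Summits.Ventures.PercRepro.RankLevelSetCoreSixColoopFreeUnion
import Summits.Ventures.PercRepro.RankLevelSetLevelSixCapGlue25
import Summits.Ventures.PercRepro.TriangleCapEightI
import Summits.Ventures.PercRepro.S1TrianglePlusSharp
import Summits.Ventures.PercRepro.S1SeriesLever14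

/-!
# PercRepro — THE CELL `(22, 20)`: device rows, part C (p8 g13, S3; tools/mkcell.py)

Axioms: standard.
-/

open scoped Matroid

namespace PercRepro

namespace ThmN

open Set Matroid

variable {α : Type}

set_option maxHeartbeats 1600000 in
/-- **The `k = 9` row of the device at `(22, 20)`**: the coloop-free part of rank `13` on `33` points (`#U ≤ 1832976418`). -/
theorem c025_t22_twenty_row_9 (M : Matroid α) [M.Finite] (hcf : ∀ e ∈ M.E, ¬ M.IsColoop e)
    (hR : M.eRank = (13 : ℕ∞)) (hn : M.E.ncard = 13 + 20)
    (hfree : ∀ e ∈ M.E, ∃ A ⊆ M.E \ {e}, e ∉ M.closure A ∧ e ∉ M.closure ((M.E \ {e}) \ A)) :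
    phiK 22 6 * (Matroid.topCount M 13 6 : ℚ) ≤
      ∑ i ∈ Finset.range (9 + 1), ((Nat.choose 9 i : ℕ) : ℚ) * (Matroid.midShift M i 22 6 : ℚ) := by
  classical
  have hR' : M.eRank = ((13 : ℕ) : ℕ∞) := hR
  have hd : M.E.encard = M.eRank + (20 : ℕ) := by
    rw [hR, ← M.ground_finite.cast_ncard_eq, hn]
    push_cast
    ring
  have hEcard : M.ground_finite.toFinset.card = 13 + 20 := by
    rw [← Set.ncard_eq_toFinset_card _ M.ground_finite]; exact hn
  have hL : ∀ e ∈ M.E, ¬ M.IsLoop e := not_isLoop_of_free M hfree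
  have hs : ∀ e ∈ M.E, ∀ f ∈ M.E, e ≠ f → M.eRk {e, f} = 2 := by
    intro e he f hf hef
    have h2 : (2 : ℕ∞) ≤ M.eRk {e, f} :=
      two_le_eRk_of_two_le_ncard_of_free M hfree (pair_subset he hf) (by rw [ncard_pair hef])
    have h3 : M.eRk {e, f} ≤ 2 := by
      have := M.eRk_le_encard {e, f}
      rwa [encard_pair hef] at this
    exact le_antisymm h3 h2
  have hc : ∀ X ⊆ M.E, M.eRk X ≤ ((6 - 2 : ℕ) : ℕ∞) → (X.ncard : ℕ∞) ≤ M.eRk X + cnull 4 :=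
    fun X hX hr => nullity_cap_core M hfree 4 (le_refl 4) X hX (by simpa using hr)
  have hc6 : cnull 4 + 1 ≤ 15 := by simp [cnull]
  have hcj : ∀ X ⊆ M.E, M.eRk X ≤ ((6 - 1 - 1 : ℕ) : ℕ∞) → (X.ncard : ℕ∞) ≤ M.eRk X + cnull (4) :=
    fun X hX hr => nullity_cap_core M hfree 4 (by omega) X hX
      (by rwa [show (6 - 1 - 1 : ℕ) = 4 by omega] at hr)
  have hUG : (Matroid.UG M 6 15).ncard ≤ 29 := by
    have := Matroid.ncard_UG_le_cf (M := M) (q := 6) (ν₁ := 15) (j := 1) (by norm_num) hcf hR' hn (by omega) hc hc6 hcj (by norm_num [cnull])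
    simpa using this
  have hcap : ∀ X ⊆ M.E, ∀ k : ℕ, M.eRk X ≤ k → X.ncard ≤ k + 20 := by
    intro X hX k hr
    have h1 := Matroid.encard_le_eRk_add_of_encard_eq hX hd
    have h2 : X.encard ≤ (k : ℕ∞) + ((20 : ℕ) : ℕ∞) := h1.trans (add_le_add_left hr _)
    have hfin : X.Finite := M.ground_finite.subset hX
    rw [← hfin.cast_ncard_eq] at h2; exact_mod_cast h2
  have hflat' : ∀ X ⊆ M.E, M.eRk X ≤ ((6 - 1 : ℕ) : ℕ∞) → X.ncard ≤ 19 :=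
    fun X hX hr => le_min (ncard_le_nineteen_of_eRk_le_five_of_free M hfree hX (by simpa using hr)) (hcap X hX 5 (by simpa using hr))
  have hUH : (Matroid.UH M 6 15).ncard ≤ 19 :=
    Matroid.ncard_UH_le_of_unique (M := M) (q := 6) (ν₁ := 15) hd hc (by norm_num [cnull]) hflat'
  have hU := topCount_le_heavy_cell_sq27di2v M 13 20 15 29 19 0 22757 1341 89 164506 610119 (by norm_num) (by norm_num)
      (by norm_num) hUG hUH (by omega) (Or.inl (by norm_num))
      (s3_cf_of M hfree hcf (d := 19) (by simpa using hd) 33 89 (by norm_num) (by omega) (by decide) (by decide) (by decide))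
      ((S1.ncard_fourCircuits_le_gb14 20 M hfree hd 33 (by rw [coloops_eq_empty_of_forall M hcf, Set.sdiff_empty, hn])).trans (by decide))
      (s5_cf_of M hfree hcf (d := 19) (by rw [hd]; norm_num) 33 19309 22757 (by norm_num) (by omega) (by decide) (by omega))
      (s6_cf_of M hfree hcf (d := 19) (by rw [hd]; norm_num) 33 134596 164506 (by norm_num) (by omega) (by decide) (by omega))
      (s7_cf_of M hfree hcf (d := 19) (by rw [hd]; norm_num) 33 480700 610119 (by norm_num) (by omega) (by decide) (by omega))
      hR' hn hfree
  have hUnum : (Matroid.topCount M 13 6 : ℚ) ≤ ((1832976418 : ℕ) : ℚ) := by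
    refine hU.trans ?_
    rw [show Finset.Icc 6 20 = Finset.Ico 6 21 from (Finset.Ico_succ_right_eq_Icc 6 20).symm]
    rw [show Finset.Icc 5 (20 - 1) = Finset.Ico 5 20 from (Finset.Ico_succ_right_eq_Icc 5 19).symm]
    simp only [Finset.sum_Ico_eq_sum_range]
    norm_num [Finset.sum_range_succ, Nat.choose]
  have hlb : ∀ i ∈ Finset.range (9 + 1),
      ((Nat.choose 9 i : ℕ) : ℚ) * ((rowLB (13 + 20) 20 9 6 i : ℕ) : ℚ) ≤
        ((Nat.choose 9 i : ℕ) : ℚ) * (Matroid.midShift M i 22 6 : ℚ) := by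
    intro i hi
    rw [Finset.mem_range] at hi
    have h := rowLB_le_midShift (M := M) hfree (k := 9) (q := 6) hR' hd (i := i) (by omega)
    rw [hEcard] at h
    exact mul_le_mul_of_nonneg_left (Nat.cast_le.mpr h) (Nat.cast_nonneg _)
  have hsum : ((∑ i ∈ Finset.range (9 + 1), Nat.choose 9 i * rowLB (13 + 20) 20 9 6 i : ℕ) : ℚ) ≤
      ∑ i ∈ Finset.range (9 + 1), ((Nat.choose 9 i : ℕ) : ℚ) * (Matroid.midShift M i 22 6 : ℚ) := by
    push_cast
    exact Finset.sum_le_sum hlb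
  have hΦ : phiK 22 6 ≤ (2 : ℚ) ^ 28 / 376740 := by
    have h := phiK_le_two_pow_div_six 22
    norm_num at h
    exact h
  have hnumq : (2 : ℚ) ^ 28 * ((1832976418 : ℕ) : ℚ) ≤
      376740 * ((∑ i ∈ Finset.range (9 + 1), Nat.choose 9 i * rowLB (13 + 20) 20 9 6 i : ℕ) : ℚ) := by
    exact_mod_cast c025_t22_twenty_row_9_num
  have hU0 : (0 : ℚ) ≤ (Matroid.topCount M 13 6 : ℚ) := Nat.cast_nonneg _
  have hS : (2 : ℚ) ^ 28 / 376740 * ((1832976418 : ℕ) : ℚ) ≤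
      ((∑ i ∈ Finset.range (9 + 1), Nat.choose 9 i * rowLB (13 + 20) 20 9 6 i : ℕ) : ℚ) := by
    rw [div_mul_eq_mul_div, div_le_iff₀ (by norm_num)]
    linarith
  calc phiK 22 6 * (Matroid.topCount M 13 6 : ℚ)
      ≤ (2 : ℚ) ^ 28 / 376740 * (Matroid.topCount M 13 6 : ℚ) := mul_le_mul_of_nonneg_right hΦ hU0
    _ ≤ (2 : ℚ) ^ 28 / 376740 * ((1832976418 : ℕ) : ℚ) := mul_le_mul_of_nonneg_left hUnum (by norm_num)
    _ ≤ _ := hS.trans hsum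

end ThmN

end PercRepro
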